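import Literature.Probability.Percolation.TriChordSides
import HarnessLib

/-!
# Chord loops, continued: the far side, outer heads, triangles, two-chain invariance

Topic `Literature/Probability/Percolation`; family `crit-perc`. Third part of the planar toolkit
for the separation arguments of Smirnov's theorem (Bollobás–Riordan, *Percolation* (2006),
Ch. 7, Claims 10–11 pp. 176–179), continuing `TriFaceLabel.lean` and `TriChordSides.lean`.
Theorems only.

* `TriMarkedDomain.faceLabel_eq_leftLabel_add_one_of_mem_Ico` — **the faces between the ends of
  a chord lie to its right**: for the chord loop of a path `Q` from the tail of position `nᵤ` to
  the tail of position `nᵥ` closed by the heads over `[nᵥ, nᵤ + #∂]`, the face left of the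
  boundary dart at each position `q ∈ [nᵤ, nᵥ)` has the label `leftLabel + 1` (anchor: the face
  right of the connecting dart `v → head nᵥ`; then rotations down the positions).
* `TriMarkedDomain.cellLabel_bdryHead_eq_zero`, `faceLabel_eq_zero_of_bdryHead_mem` — for a
  closed chain of sites of `G` every outer head (hence every face with an outer vertex) has
  label `0` (`exists_bdryHead_east`: a head east of all of `G`).
* `faceLabel_triangle_self(')`, `cellLabel_triangle_eq_zero`, `isTriLoop_faceVertex(')`,
  `faceLabel_three_darts_eq_one` — the boundary of a face: the face has label `1`, every other
  cell `0`.
* `faceLabel_add_eq_of_reflTransGen_dualStep` — **two closed chains with the same allowed bonds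
  have labels with invariant sum along dual paths** (how "inside one loop iff inside the other"
  is transported); `faceLabel_add_faceLabel_of_adj`, `IsTriLoop.lbond_eq_ite`.
* Bookkeeping: labels are additive in the dart list and blind to orientation
  (`faceLabel_append`, `faceLabel_perm`, `faceLabel_cons_swap`); bonds of walks as bonds of
  their supports (`sym2_mem_edges_iff_pathDarts`, `mem_pathDarts_support_iff`); bonds of
  concatenations / reversals / three-piece lists; replacing a segment of a list
  (`isChain_append3_of_isChain`, `nodup_append3_of_nodup`, …); periodicity
  (`headsList_add_card`); target faces as faces left of boundary darts
  (`exists_eq_leftFace_of_stretch_zero`).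

## References

* B. Bollobás, O. Riordan, *Percolation*, Cambridge University Press (2006), Ch. 7 §7.2.2
  pp. 176–179.

## Mathlib / tree

Tree: `TriFaceLabel.lean`, `TriChordSides.lean`; `TriMarkedDomain` (`TriDiscreteDomain.lean`).
Mathlib: `List.IsChain`, `List.Perm`, `SimpleGraph.Walk` (`edges`, `darts`, `support`).
-/

namespace Literature.Probability.Percolation

open LatticeModels Finset
open RemovableAt (hexFaceVertices_leftFaceDir)

/-! ## (γ): the faces at the complementary boundary positions lie to the right of a chord loop -/

namespace TriMarkedDomain

variable {k : ℕ} (D : TriMarkedDomain k)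

/-- **The faces left of the boundary darts between the ends of a chord lie to the right of the
chord loop.** For the chord loop of `Q` (from the tail `u` of position `nᵤ = nᵥ + len - #∂` to
the tail `v` of position `nᵥ`, closed by the heads over `[nᵥ, nᵥ + len]`), the face left of the
boundary dart at each position `q` with `nᵤ ≤ q < nᵥ` has the label `leftLabel + 1`: at
`q = nᵥ - 1` it is the face right of the connecting dart `v → head nᵥ` (apex identity), and
going down one position is a rotation across the bond from the head to the new tail
(head-keeping step) or from the tail to the new head (tail-keeping step), never a bond of the
loop (the loop's darts with an outer endpoint are the two connecting darts, at the positions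
`nᵥ, nᵤ`, and the turns of the heads, outer–outer). [folklore] -/
theorem faceLabel_eq_leftLabel_add_one_of_mem_Ico {Q : List (Site 2)} (hQ : Q ≠ []) (hQG : ∀ x ∈ Q, x ∈ D.verts)
    {nu nv len : ℕ} (hlt : nu < nv) (hnvL : nv < nu + #(triBdryDarts D.verts))
    (hlen : nv + len = nu + #(triBdryDarts D.verts))
    (hlast : Q.getLast hQ = (triBdryIter D.verts D.base nv).1)
    (hhead : Q.head hQ = (triBdryIter D.verts D.base (nv + len)).1)
    (hC : IsTriLoop (D.chordLoop Q nv len)) {q : ℕ} (hq : nu ≤ q) (hq' : q + 1 ≤ nv) :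
    faceLabel (cycDarts (D.chordLoop Q nv len)) (leftFace (triBdryIter D.verts D.base q).1 (D.bdryHead q)) =
      leftLabel (D.chordLoop Q nv len) + 1 := by
  set L := #(triBdryDarts D.verts) with hL
  set C := D.chordLoop Q nv len with hCdef
  have hLpos : 0 < L := D.isTriDisc.card_pos
  have hadjq : ∀ q, triGraph.Adj (triBdryIter D.verts D.base q).1 (D.bdryHead q) := fun q => D.adj_fst_bdryHead q
  have hoG : ∀ q, D.bdryHead q ∉ D.verts := fun q => D.bdryHead_not_mem q
  have htG : ∀ q, (triBdryIter D.verts D.base q).1 ∈ D.verts := fun q => D.iter_fst_mem q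
  have hread : ∀ q, ((triBdryIter D.verts D.base (q + 1)).1 =
        triLeftApex (triBdryIter D.verts D.base q).1 (D.bdryHead q) ∧ D.bdryHead (q + 1) = D.bdryHead q) ∨
      ((triBdryIter D.verts D.base (q + 1)).1 = (triBdryIter D.verts D.base q).1 ∧
        D.bdryHead (q + 1) = triLeftApex (triBdryIter D.verts D.base q).1 (D.bdryHead q)) := by
    intro q
    rcases D.iter_succ_eq_or q with ⟨h, -⟩ | ⟨h, -⟩
    · right
      constructor
      · show (triBdryIter D.verts D.base (q + 1)).1 = _
        rw [h]
      · show (triBdryIter D.verts D.base (q + 1)).2 = _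
        rw [h]; rfl
    · left
      constructor
      · show (triBdryIter D.verts D.base (q + 1)).1 = _
        rw [h]; rfl
      · show (triBdryIter D.verts D.base (q + 1)).2 = _
        rw [h]; rfl
  -- the bond of the dart at a position strictly between `nᵤ` and `nᵥ` is not a bond of the loop
  have hbond : ∀ p, nu < p → p < nv →
      lbond (cycDarts C) (triBdryIter D.verts D.base p).1 (D.bdryHead p) = 0 := by
    intro p hp1 hp2
    have hne1 : triBdryIter D.verts D.base p ≠ triBdryIter D.verts D.base nv := by
      intro he
      have := D.isTriDisc.iter_eq_iter_iff.1 he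
      have key := Nat.sub_mod_eq_zero_of_mod_eq this.symm
      rw [Nat.mod_eq_of_lt (show nv - p < L by omega)] at key
      omega
    have hne2 : triBdryIter D.verts D.base p ≠ triBdryIter D.verts D.base (nv + len) := by
      intro he
      have := D.isTriDisc.iter_eq_iter_iff.1 he
      have key := Nat.sub_mod_eq_zero_of_mod_eq this.symm
      rw [hlen, Nat.mod_eq_of_lt (show nu + L - p < L by omega)] at key
      omega
    refine lbond_eq_zero_of_forall_sym2_ne fun d hd he => ?_
    have ht_mem : (triBdryIter D.verts D.base p).1 ∈ s(d.1, d.2) := by rw [he]; exact Sym2.mem_mk_left _ _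
    have ho_mem : D.bdryHead p ∈ s(d.1, d.2) := by rw [he]; exact Sym2.mem_mk_right _ _
    rw [hCdef, D.cycDarts_chordLoop hQ, List.mem_append, List.mem_cons, List.mem_append,
      List.mem_singleton] at hd
    rcases hd with hd | rfl | hd | rfl
    · obtain ⟨h1, h2⟩ := mem_of_mem_pathDarts hd
      rcases Sym2.mem_iff.1 ho_mem with h | h
      · exact hoG p (h ▸ hQG _ h1)
      · exact hoG p (h ▸ hQG _ h2)
    · -- the connecting dart `v → head nᵥ`
      rcases Sym2.mem_iff.1 ht_mem with h | h
      · -- tails equal and (hence) heads equal: the same dart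
        simp only at h
        rcases Sym2.mem_iff.1 ho_mem with h' | h'
        · exact hoG p (h' ▸ hQG _ (List.getLast_mem hQ))
        · apply hne1
          rw [D.iter_eq_mk p, D.iter_eq_mk nv, ← hlast]
          exact Prod.ext h h'
      · exact hoG nv (by simp only at h; rw [← h]; exact htG p)
    · obtain ⟨r, -, -, -, rfl⟩ := D.mem_pathDarts_headsList hd
      rcases Sym2.mem_iff.1 ht_mem with h | h
      · exact hoG r (by simp only at h; rw [← h]; exact htG p)
      · exact hoG (r + 1) (by simp only at h; rw [← h]; exact htG p)
    · rcases Sym2.mem_iff.1 ht_mem with h | h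
      · exact hoG (nv + len) (by simp only at h; rw [← h]; exact htG p)
      · simp only at h
        rcases Sym2.mem_iff.1 ho_mem with h' | h'
        · apply hne2
          rw [D.iter_eq_mk p, D.iter_eq_mk (nv + len), ← hhead]
          exact Prod.ext h h'
        · exact hoG p (h' ▸ hQG _ (List.head_mem hQ))
  -- base: the face left of the dart at `nᵥ - 1` is right of the connecting dart `v → head nᵥ`
  have hconn : (Q.getLast hQ, D.bdryHead nv) ∈ cycDarts C := by
    rw [hCdef, D.cycDarts_chordLoop hQ]
    exact List.mem_append_right _ List.mem_cons_self
  have hbase : faceLabel (cycDarts C)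
      (leftFace (triBdryIter D.verts D.base (nv - 1)).1 (D.bdryHead (nv - 1))) = leftLabel C + 1 := by
    rw [← hC.faceLabel_rightFace hconn]
    congr 1
    simp only
    rw [hlast]
    have ep : nv - 1 + 1 = nv := by omega
    have hvo : triGraph.Adj (D.bdryHead nv) (triBdryIter D.verts D.base nv).1 := (hadjq nv).symm
    symm
    rcases hread (nv - 1) with ⟨ht, ho⟩ | ⟨ht, ho⟩
    · rw [ep] at ht ho
      -- head kept: `v = apex (t₋ → o_v)`, so `apex (o_v → v) = t₋`
      refine eq_leftFace_of_mem (hadjq (nv - 1)) ?_ ?_ ?_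
      · rw [hexFaceVertices_leftFace hvo, ht, ho, triLeftApex_triLeftApex (hadjq (nv - 1))]; simp
      · rw [hexFaceVertices_leftFace hvo, ho]; simp
      · rw [hexFaceVertices_leftFace hvo, ← ht]; simp
    · rw [ep] at ht ho
      -- tail kept: `o_v = apex (v → o)`, so `apex (o_v → v) = o`
      have h1 : triLeftApex (D.bdryHead (nv - 1)) (D.bdryHead nv) = (triBdryIter D.verts D.base nv).1 := by
        rw [ho, triLeftApex_triLeftApex (hadjq (nv - 1)), ht]
      have hho : triGraph.Adj (D.bdryHead (nv - 1)) (D.bdryHead nv) := by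
        rw [ho]; exact (triGraph_adj_triLeftApex_right (hadjq (nv - 1))).symm
      have h2 : triLeftApex (D.bdryHead nv) (triBdryIter D.verts D.base nv).1 = D.bdryHead (nv - 1) := by
        rw [← h1, triLeftApex_triLeftApex hho]
      refine eq_leftFace_of_mem (hadjq (nv - 1)) ?_ ?_ ?_
      · rw [hexFaceVertices_leftFace hvo, ← ht]; simp
      · rw [hexFaceVertices_leftFace hvo, h2]; simp
      · rw [hexFaceVertices_leftFace hvo, ← ho]; simp
  -- downward induction on the position
  have key : ∀ j : ℕ, j + nu + 1 ≤ nv → faceLabel (cycDarts C)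
      (leftFace (triBdryIter D.verts D.base (nv - 1 - j)).1 (D.bdryHead (nv - 1 - j))) = leftLabel C + 1 := by
    intro j
    induction j with
    | zero => intro _; simpa using hbase
    | succ j ih =>
      intro hj
      have ih' := ih (by omega)
      set p := nv - 1 - (j + 1) with hpdef
      have hp1 : nv - 1 - j = p + 1 := by omega
      rw [hp1] at ih'
      rw [← ih']
      have hb0 := hbond (p + 1) (by omega) (by omega)
      rcases hread p with ⟨ht', ho⟩ | ⟨ht, ho'⟩
      · -- head kept: rotate about the head `o` across the bond to the new tail
        set o := D.bdryHead p with hodef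
        set t := (triBdryIter D.verts D.base p).1 with htdef
        set α := dirOf o t with hα
        have htq : t = o + triDir α := eq_add_triDir_dirOf (hadjq p).symm
        have e1 : leftFace t o = leftFaceDir o (α + 5) := by rw [htq, leftFace_add_triDir_rev]
        have e2 : triLeftApex t o = o + triDir (α + 5) := by rw [htq, triLeftApex_add_triDir_left]
        have e45 : α + 5 = α + 4 + 1 := by rw [add_assoc]; rfl
        have e3 : leftFace (triLeftApex t o) o = leftFaceDir o (α + 4) := by
          rw [e2, leftFace_add_triDir_rev, add_assoc]
          congr 1
        rw [ht', ho, e3, e1, e45]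
        refine (faceLabel_eq_of_adj hC.adj (hexGraph_adj_leftFaceDir_succ o (α + 4)) fun x y hxy => ?_).symm
        rw [faceEdge_leftFaceDir_succ, ← e45] at hxy
        rw [ht', ho, e2, lbond_comm] at hb0
        have hx : x ∈ ({o, o + triDir (α + 5)} : Finset (Site 2)) := by rw [hxy]; simp
        have hy : y ∈ ({o, o + triDir (α + 5)} : Finset (Site 2)) := by rw [hxy]; simp
        have hne : x ≠ y := by
          intro hxy'
          have hcard : ({o, o + triDir (α + 5)} : Finset (Site 2)).card = 2 := card_pair (add_triDir_ne o _).symm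
          rw [hxy, hxy', Finset.pair_eq_singleton, card_singleton] at hcard
          exact absurd hcard (by norm_num)
        simp only [Finset.mem_insert, Finset.mem_singleton] at hx hy
        rcases hx with rfl | rfl <;> rcases hy with rfl | rfl
        · exact absurd rfl hne
        · exact hb0
        · rw [lbond_comm]; exact hb0
        · exact absurd rfl hne
      · -- tail kept: rotate about the tail `t` across the bond to the new head
        set o := D.bdryHead p with hodef
        set t := (triBdryIter D.verts D.base p).1 with htdef
        set β := dirOf t o with hβ
        have hto : o = t + triDir β := eq_add_triDir_dirOf (hadjq p)
        have e1 : leftFace t o = leftFaceDir t β := by rw [hto, leftFace_add_triDir]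
        have e2 : triLeftApex t o = t + triDir (β + 1) := by rw [hto, triLeftApex_add_triDir]
        have e3 : leftFace t (triLeftApex t o) = leftFaceDir t (β + 1) := by rw [e2, leftFace_add_triDir]
        rw [ht, ho', e3, e1]
        refine faceLabel_eq_of_adj hC.adj (hexGraph_adj_leftFaceDir_succ t β) fun x y hxy => ?_
        rw [faceEdge_leftFaceDir_succ] at hxy
        rw [ht, ho', e2] at hb0
        have hx : x ∈ ({t, t + triDir (β + 1)} : Finset (Site 2)) := by rw [hxy]; simp
        have hy : y ∈ ({t, t + triDir (β + 1)} : Finset (Site 2)) := by rw [hxy]; simp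
        have hne : x ≠ y := by
          intro hxy'
          have hcard : ({t, t + triDir (β + 1)} : Finset (Site 2)).card = 2 := card_pair (add_triDir_ne t _).symm
          rw [hxy, hxy', Finset.pair_eq_singleton, card_singleton] at hcard
          exact absurd hcard (by norm_num)
        simp only [Finset.mem_insert, Finset.mem_singleton] at hx hy
        rcases hx with rfl | rfl <;> rcases hy with rfl | rfl
        · exact absurd rfl hne
        · exact hb0
        · rw [lbond_comm]; exact hb0
        · exact absurd rfl hne
  have := key (nv - 1 - q) (by omega)
  have e : nv - 1 - (nv - 1 - q) = q := by omega
  rwa [e] at this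

end TriMarkedDomain

/-! ## Loops inside the domain: the outer heads are outside -/

namespace TriMarkedDomain

variable {k : ℕ} (D : TriMarkedDomain k)

/-- **There is an outer head east of the whole domain**: the east neighbour of an eastmost site. [folklore] -/
theorem exists_bdryHead_east : ∃ n, ∀ s ∈ D.verts, s 0 < D.bdryHead n 0 := by
  have hne : D.verts.Nonempty := ⟨_, D.iter_fst_mem 0⟩
  obtain ⟨s₀, hs₀, hmax⟩ := Finset.exists_max_image D.verts (fun s => s 0) hne
  have hout : s₀ + Pi.single 0 1 ∉ D.verts := by
    intro hin
    have := hmax _ hin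
    simp at this
  have hd : (s₀, s₀ + Pi.single 0 1) ∈ triBdryDarts D.verts :=
    mem_triBdryDarts.2 ⟨hs₀, hout, by
      have := triGraph_adj_add_triDir s₀ 0
      simpa [triDir] using this⟩
  obtain ⟨n, -, hn⟩ := D.cycle _ hd
  refine ⟨n, fun s hs => ?_⟩
  have e : D.bdryHead n = s₀ + Pi.single 0 1 := by unfold bdryHead; rw [hn]
  rw [e]
  have := hmax s hs
  simp only [Pi.add_apply, Pi.single_eq_same]
  omega

/-- **For a closed chain of sites of the domain, all outer heads have the cell label `0`**: they
are joined along `∂⁺G` (consecutive heads are equal or adjacent), off the chain, to a head east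
of the whole chain. [folklore] -/
theorem cellLabel_bdryHead_eq_zero {l : List (Site 2)} (hadj : ∀ d ∈ cycDarts l, triGraph.Adj d.1 d.2)
    (hG : ∀ d ∈ cycDarts l, d.1 ∈ D.verts ∧ d.2 ∈ D.verts) (n : ℕ) : cellLabel (cycDarts l) (D.bdryHead n) = 0 := by
  have hz : ∀ m, ∀ d ∈ cycDarts l, d.1 ≠ D.bdryHead m ∧ d.2 ≠ D.bdryHead m := fun m d hd =>
    ⟨fun e => D.bdryHead_not_mem m (e ▸ (hG d hd).1), fun e => D.bdryHead_not_mem m (e ▸ (hG d hd).2)⟩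
  have hsucc : ∀ m, cellLabel (cycDarts l) (D.bdryHead (m + 1)) = cellLabel (cycDarts l) (D.bdryHead m) := by
    intro m
    rcases D.bdryHead_succ_eq_or_adj m with h | h
    · rw [h]
    · exact (cellLabel_eq_of_adj hadj h (hz m) (hz (m + 1))).symm
  have hall : ∀ m, cellLabel (cycDarts l) (D.bdryHead m) = cellLabel (cycDarts l) (D.bdryHead 0) := by
    intro m
    induction m with
    | zero => rfl
    | succ m ih => rw [hsucc, ih]
  obtain ⟨n₀, hn₀⟩ := D.exists_bdryHead_east
  rw [hall n, ← hall n₀]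
  exact cellLabel_eq_zero_of_forall_le fun d hd => ⟨(hn₀ _ (hG d hd).1).le, (hn₀ _ (hG d hd).2).le⟩

/-- A face with an outer vertex has label `0` with respect to a closed chain of sites of the
domain; in particular every face seen from a boundary dart. [folklore] -/
theorem faceLabel_eq_zero_of_bdryHead_mem {l : List (Site 2)} (hadj : ∀ d ∈ cycDarts l, triGraph.Adj d.1 d.2)
    (hG : ∀ d ∈ cycDarts l, d.1 ∈ D.verts ∧ d.2 ∈ D.verts) {F : HexVertex} {n : ℕ}
    (hF : D.bdryHead n ∈ hexFaceVertices F) : faceLabel (cycDarts l) F = 0 := by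
  have hz : ∀ d ∈ cycDarts l, d.1 ≠ D.bdryHead n ∧ d.2 ≠ D.bdryHead n := fun d hd =>
    ⟨fun e => D.bdryHead_not_mem n (by rw [← e]; exact (hG d hd).1),
      fun e => D.bdryHead_not_mem n (by rw [← e]; exact (hG d hd).2)⟩
  rw [faceLabel_eq_cellLabel_of_mem hadj hz hF]
  exact D.cellLabel_bdryHead_eq_zero hadj hG n

end TriMarkedDomain

/-! ## The triangle loop around a face -/

/-- The closed darts of a three-element list. [folklore] -/
theorem cycDarts_triple (p q r : Site 2) : cycDarts [p, q, r] = [(p, q), (q, r), (r, p)] := rfl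

/-- **The boundary of a face is a lattice loop.** [folklore] -/
theorem isTriLoop_faceVertex (w : HexVertex) : IsTriLoop [faceVertex w 0, faceVertex w 1, faceVertex w 2] := by
  refine ⟨?_, by simp, ?_⟩
  · have h := faceVertex_injective w
    have h01 : faceVertex w 0 ≠ faceVertex w 1 := fun e => absurd (h e) (by decide)
    have h02 : faceVertex w 0 ≠ faceVertex w 2 := fun e => absurd (h e) (by decide)
    have h12 : faceVertex w 1 ≠ faceVertex w 2 := fun e => absurd (h e) (by decide)
    simp [h01, h02, h12]
  · rw [cycDarts_triple]
    intro d hd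
    simp only [List.mem_cons, List.not_mem_nil, or_false] at hd
    rcases hd with rfl | rfl | rfl
    · exact TriMarkedDomain.adj_faceVertex_succ w 0
    · exact TriMarkedDomain.adj_faceVertex_succ w 1
    · exact TriMarkedDomain.adj_faceVertex_succ w 2

/-- **A face lies to the left of its own boundary, with label `1`** (a direct count of the
crossings of the ray from its centroid). [folklore] -/
theorem faceLabel_triangle_self (w : HexVertex) :
    faceLabel (cycDarts [faceVertex w 0, faceVertex w 1, faceVertex w 2]) w = 1 := by
  rcases w with ⟨c, t⟩
  by_cases ht : t = 0
  · subst ht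
    simp [cycDarts_triple, faceLabel, lRayCount, dsum, faceVertex, zind, RayCross]
  · obtain rfl : t = 1 := by
      rcases Fin.exists_fin_two.1 ⟨t, rfl⟩ with h' | h'
      · exact (ht h').elim
      · exact h'
    simp [cycDarts_triple, faceLabel, lRayCount, lEdgeParity, dsum, faceVertex, zind, RayCross, IsDEdge]
    decide

/-- Three indicators with an even number of true conditions sum to `0` in `ℤ/2`. [folklore] -/
theorem zind_add_eq_zero_of_even {P Q R : Prop} [Decidable P] [Decidable Q] [Decidable R]
    (h : ((P ↔ Q) ∧ ¬R) ∨ ((P ↔ R) ∧ ¬Q) ∨ ((Q ↔ R) ∧ ¬P)) : zind P + (zind Q + (zind R + 0)) = 0 := by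
  by_cases hp : P <;> by_cases hq : Q <;> by_cases hr : R <;>
    simp only [zind, hp, hq, hr, if_true, if_false] <;> first | decide | (exfalso; tauto)

/-- **Every other cell lies outside**: a cell that is not a vertex of the face has label `0`. [folklore] -/
theorem cellLabel_triangle_eq_zero (w : HexVertex) {y : Site 2} (hy : y ∉ hexFaceVertices w) :
    cellLabel (cycDarts [faceVertex w 0, faceVertex w 1, faceVertex w 2]) y = 0 := by
  rcases w with ⟨c, t⟩
  unfold cellLabel
  rw [faceLabel_up, cycDarts_triple]
  unfold lRayCount dsum
  simp only [List.map_cons, List.map_nil, List.sum_cons, List.sum_nil]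
  apply zind_add_eq_zero_of_even
  by_cases ht : t = 0
  · subst ht
    rw [mem_hexFaceVertices_zero] at hy
    simp only [Site.eq_iff_two, Pi.add_apply, Pi.single_apply] at hy
    simp only [faceVertex, RayCross]
    simp at hy ⊢
    omega
  · obtain rfl : t = 1 := by
      rcases Fin.exists_fin_two.1 ⟨t, rfl⟩ with h' | h'
      · exact (ht h').elim
      · exact h'
    rw [mem_hexFaceVertices_one] at hy
    simp only [Site.eq_iff_two, Pi.add_apply, Pi.single_apply] at hy
    simp only [faceVertex, RayCross]
    simp at hy ⊢
    omega

/-! ## Two closed chains with the same crossable bonds: the sum of the labels is invariant -/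

/-- Bond multiplicities only depend on the bond. [folklore] -/
theorem lbond_congr (Dl : List (Site 2 × Site 2)) {a b x y : Site 2} (h : s(a, b) = s(x, y)) :
    lbond Dl a b = lbond Dl x y := by
  unfold lbond; simp_rw [h]

/-- **The label rule across a side, for adjacent faces**: the labels of two adjacent faces differ
by the multiplicity of the bond of their common side. [folklore] -/
theorem faceLabel_add_faceLabel_of_adj {l : List (Site 2)} (hadj : ∀ d ∈ cycDarts l, triGraph.Adj d.1 d.2)
    {F F' : HexVertex} (hFF' : hexGraph.Adj F F') {x y : Site 2} (hxy : faceEdge F F' = {x, y}) :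
    faceLabel (cycDarts l) F + faceLabel (cycDarts l) F' = lbond (cycDarts l) x y := by
  obtain ⟨j, rfl⟩ := exists_oppFace_eq_of_hexGraph_adj hFF'
  rw [faceLabel_add_faceLabel_oppFace hadj F j]
  apply lbond_congr
  rw [faceEdge_oppFace] at hxy
  -- `{a, b} = {x, y}` as sets gives `s(a, b) = s(x, y)`
  have hab : faceVertex F (j + 1) ≠ faceVertex F (j + 2) := fun e =>
    absurd (add_left_cancel (faceVertex_injective F e)) (by decide)
  have ha : faceVertex F (j + 1) ∈ ({x, y} : Finset (Site 2)) := by rw [← hxy]; simp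
  have hb : faceVertex F (j + 2) ∈ ({x, y} : Finset (Site 2)) := by rw [← hxy]; simp
  simp only [Finset.mem_insert, Finset.mem_singleton] at ha hb
  rcases ha with ha | ha <;> rcases hb with hb | hb
  · exact absurd (ha.trans hb.symm) hab
  · rw [ha, hb]
  · rw [ha, hb, Sym2.eq_swap]
  · exact absurd (ha.trans hb.symm) hab

/-- **Two closed chains with equal multiplicities on every allowed bond of `G` have labels with
invariant sum along dual paths of `G` through allowed bonds** (each step changes both labels by
the same amount). This is how "inside one loop if and only if inside the other" is transported. [folklore] -/
theorem faceLabel_add_eq_of_reflTransGen_dualStep {l₁ l₂ : List (Site 2)}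
    (h₁ : ∀ d ∈ cycDarts l₁, triGraph.Adj d.1 d.2) (h₂ : ∀ d ∈ cycDarts l₂, triGraph.Adj d.1 d.2)
    {G : Finset (Site 2)} {B : Set (Sym2 (Site 2))}
    (hpar : ∀ x y, x ∈ G → y ∈ G → s(x, y) ∉ B → lbond (cycDarts l₁) x y = lbond (cycDarts l₂) x y)
    {F F' : HexVertex} (h : Relation.ReflTransGen (DualStep G B) F F') :
    faceLabel (cycDarts l₁) F + faceLabel (cycDarts l₂) F =
      faceLabel (cycDarts l₁) F' + faceLabel (cycDarts l₂) F' := by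
  induction h with
  | refl => rfl
  | @tail F₁ F₂ _ hstep ih =>
    rw [ih]
    obtain ⟨hadj', hsub, hnot⟩ := hstep
    obtain ⟨x, y, -, hxy⟩ := exists_faceEdge_eq_pair hadj'
    have hx : x ∈ G := hsub (by rw [hxy]; simp)
    have hy : y ∈ G := hsub (by rw [hxy]; simp)
    have r₁ := faceLabel_add_faceLabel_of_adj h₁ hadj' hxy
    have r₂ := faceLabel_add_faceLabel_of_adj h₂ hadj' hxy
    have hp := hpar x y hx hy (hnot x y hxy)
    have key : ∀ a a' b b' m : ZMod 2, a + a' = m → b + b' = m → a + b = a' + b' := by decide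
    exact key _ _ _ _ _ r₁ (hp ▸ r₂)

/-! ## Walks as lists of sites -/

/-- **The bonds of a walk are the bonds of the darts of its support.** [folklore] -/
theorem sym2_mem_edges_iff_pathDarts {u v : Site 2} (p : triGraph.Walk u v) {x y : Site 2} :
    s(x, y) ∈ p.edges ↔ (x, y) ∈ pathDarts p.support ∨ (y, x) ∈ pathDarts p.support := by
  induction p with
  | nil => simp
  | @cons a b c h q ih =>
    rw [SimpleGraph.Walk.edges_cons, List.mem_cons, SimpleGraph.Walk.support_cons]
    have hq : q.support = b :: q.support.tail := (q.cons_tail_support).symm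
    rw [hq, pathDarts_cons_cons, ← hq, List.mem_cons, List.mem_cons, ih]
    constructor
    · rintro (h | h | h)
      · rcases Sym2.eq_iff.1 h with ⟨rfl, rfl⟩ | ⟨rfl, rfl⟩
        · exact Or.inl (Or.inl rfl)
        · exact Or.inr (Or.inl rfl)
      · exact Or.inl (Or.inr h)
      · exact Or.inr (Or.inr h)
    · rintro ((h | h) | (h | h))
      · left; rw [Prod.mk.injEq] at h; rw [h.1, h.2]
      · exact Or.inr (Or.inl h)
      · left; rw [Prod.mk.injEq] at h; rw [h.1, h.2, Sym2.eq_swap]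
      · exact Or.inr (Or.inr h)

/-- The darts of the support of a walk are darts of `𝕋`. [folklore] -/
theorem adj_of_mem_pathDarts_support {u v : Site 2} (p : triGraph.Walk u v) {d : Site 2 × Site 2}
    (hd : d ∈ pathDarts p.support) : triGraph.Adj d.1 d.2 :=
  adj_of_mem_pathDarts p.isChain_adj_support d hd

/-! ## Labels are additive in the dart list and blind to the orientation of darts -/

/-- `dsum` over a concatenation. [folklore] -/
theorem dsum_append (f : Site 2 → Site 2 → ZMod 2) (D₁ D₂ : List (Site 2 × Site 2)) :
    dsum f (D₁ ++ D₂) = dsum f D₁ + dsum f D₂ := by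
  unfold dsum; rw [List.map_append, List.sum_append]

/-- `dsum` is invariant under permutations of the darts. [folklore] -/
theorem dsum_perm (f : Site 2 → Site 2 → ZMod 2) {D₁ D₂ : List (Site 2 × Site 2)} (h : D₁.Perm D₂) :
    dsum f D₁ = dsum f D₂ := by
  unfold dsum; exact (h.map _).sum_eq

/-- **Labels are additive in the dart list.** [folklore] -/
theorem faceLabel_append (D₁ D₂ : List (Site 2 × Site 2)) (F : HexVertex) :
    faceLabel (D₁ ++ D₂) F = faceLabel D₁ F + faceLabel D₂ F := by
  unfold faceLabel lRayCount lEdgeParity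
  split_ifs
  · rw [dsum_append]
  · rw [dsum_append, dsum_append]; abel

/-- Labels are invariant under permutations of the darts. [folklore] -/
theorem faceLabel_perm {D₁ D₂ : List (Site 2 × Site 2)} (h : D₁.Perm D₂) (F : HexVertex) :
    faceLabel D₁ F = faceLabel D₂ F := by
  unfold faceLabel lRayCount lEdgeParity
  rw [dsum_perm _ h, dsum_perm _ h]

/-- **Labels do not see the orientation of a dart.** [folklore] -/
theorem faceLabel_cons_swap (p q : Site 2) (D : List (Site 2 × Site 2)) (F : HexVertex) :
    faceLabel ((q, p) :: D) F = faceLabel ((p, q) :: D) F := by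
  have h1 : ∀ a b : ℤ, RayCross a b q p ↔ RayCross a b p q := by
    intro a b; unfold RayCross; constructor <;> (intro h; omega)
  have h2 : ∀ a b : ℤ, IsDEdge a b q p ↔ IsDEdge a b p q := by
    intro a b; unfold IsDEdge; tauto
  unfold faceLabel lRayCount lEdgeParity
  simp only [dsum_cons, zind_congr (h1 _ _), zind_congr (h2 _ _)]

/-- A dart list counted twice contributes nothing. [folklore] -/
theorem faceLabel_append_self (D : List (Site 2 × Site 2)) (F : HexVertex) : faceLabel (D ++ D) F = 0 := by
  rw [faceLabel_append, CharTwo.add_self_eq_zero]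

/-! ## Bonds of lists: concatenation, reversal -/

/-- The darts of a reversed list are the reversed darts. [folklore] -/
theorem mem_pathDarts_reverse {l : List (Site 2)} {x y : Site 2} :
    (x, y) ∈ pathDarts l.reverse ↔ (y, x) ∈ pathDarts l := by
  induction l with
  | nil => simp
  | cons a t ih =>
    cases t with
    | nil => simp
    | cons b t' =>
      rw [List.reverse_cons, pathDarts_append_singleton (by simp), List.mem_append, List.mem_singleton, ih,
        pathDarts_cons_cons, List.mem_cons, List.getLast_reverse]
      simp only [List.head_cons, Prod.mk.injEq]
      tauto

/-- **The bonds of a concatenation**: those of the pieces and the connecting bond. [folklore] -/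
theorem exists_mem_pathDarts_append_iff {l₁ l₂ : List (Site 2)} (h₁ : l₁ ≠ []) (h₂ : l₂ ≠ []) {e : Sym2 (Site 2)} :
    (∃ d ∈ pathDarts (l₁ ++ l₂), e = s(d.1, d.2)) ↔
      (∃ d ∈ pathDarts l₁, e = s(d.1, d.2)) ∨ (∃ d ∈ pathDarts l₂, e = s(d.1, d.2)) ∨
        e = s(l₁.getLast h₁, l₂.head h₂) := by
  rw [pathDarts_append h₁ h₂]
  simp only [List.mem_append, List.mem_cons]
  constructor
  · rintro ⟨d, hd | rfl | hd, rfl⟩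
    · exact Or.inl ⟨d, hd, rfl⟩
    · exact Or.inr (Or.inr rfl)
    · exact Or.inr (Or.inl ⟨d, hd, rfl⟩)
  · rintro (⟨d, hd, rfl⟩ | ⟨d, hd, rfl⟩ | rfl)
    · exact ⟨d, Or.inl hd, rfl⟩
    · exact ⟨d, Or.inr (Or.inr hd), rfl⟩
    · exact ⟨_, Or.inr (Or.inl rfl), rfl⟩

/-- The bonds of a reversed list are the same. [folklore] -/
theorem exists_mem_pathDarts_reverse_iff {l : List (Site 2)} {e : Sym2 (Site 2)} :
    (∃ d ∈ pathDarts l.reverse, e = s(d.1, d.2)) ↔ ∃ d ∈ pathDarts l, e = s(d.1, d.2) := by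
  constructor
  · rintro ⟨⟨x, y⟩, hd, rfl⟩
    exact ⟨(y, x), mem_pathDarts_reverse.1 hd, Sym2.eq_swap⟩
  · rintro ⟨⟨x, y⟩, hd, rfl⟩
    exact ⟨(y, x), mem_pathDarts_reverse.2 (by simpa using hd), Sym2.eq_swap⟩

/-- The bonds of a one-element list: none. [folklore] -/
theorem not_exists_mem_pathDarts_singleton (a : Site 2) {e : Sym2 (Site 2)} :
    ¬ ∃ d ∈ pathDarts [a], e = s(d.1, d.2) := by simp

/-- **A bond of a lattice loop has multiplicity one, any other bond multiplicity zero.** [folklore] -/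
theorem IsTriLoop.lbond_eq_ite {l : List (Site 2)} (h : IsTriLoop l) (x y : Site 2) :
    lbond (cycDarts l) x y = if ∃ d ∈ cycDarts l, s(x, y) = s(d.1, d.2) then 1 else 0 := by
  split_ifs with hex
  · obtain ⟨d, hd, he⟩ := hex
    rcases Sym2.eq_iff.1 he with ⟨h1, h2⟩ | ⟨h1, h2⟩
    · rw [h1, h2]; exact h.lbond_eq_one (by rw [Prod.mk.eta]; exact hd)
    · rw [h1, h2, lbond_comm]; exact h.lbond_eq_one (by rw [Prod.mk.eta]; exact hd)
  · push Not at hex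
    exact lbond_eq_zero_of_forall_sym2_ne fun d hd he => hex d hd he.symm

/-! ## Replacing a segment of a list -/

/-- The head of `L₁ ++ S ++ L₂` only depends on the head of `S`. [folklore] -/
theorem head_append3_eq {L₁ S S' L₂ : List (Site 2)} (hS : S ≠ []) (hS' : S' ≠ [])
    (h : S'.head hS' = S.head hS) :
    (L₁ ++ S' ++ L₂).head (by simp [hS']) = (L₁ ++ S ++ L₂).head (by simp [hS]) := by
  cases L₁ with
  | nil => simp only [List.nil_append, List.head_append_of_ne_nil hS', List.head_append_of_ne_nil hS, h]
  | cons a t => rfl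

/-- The last element of `L₁ ++ S ++ L₂` only depends on the last element of `S`. [folklore] -/
theorem getLast_append3_eq {L₁ S S' L₂ : List (Site 2)} (hS : S ≠ []) (hS' : S' ≠ [])
    (h : S'.getLast hS' = S.getLast hS) :
    (L₁ ++ S' ++ L₂).getLast (by simp [hS']) = (L₁ ++ S ++ L₂).getLast (by simp [hS]) := by
  by_cases hL₂ : L₂ = []
  · subst hL₂
    simp only [List.append_nil, List.getLast_append_of_right_ne_nil _ _ hS',
      List.getLast_append_of_right_ne_nil _ _ hS, h]
  · simp only [List.getLast_append_of_right_ne_nil _ _ hL₂]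

/-- **Replacing a segment by a chain with the same ends keeps the list a chain.** [folklore] -/
theorem isChain_append3_of_isChain {R : Site 2 → Site 2 → Prop} {L₁ S S' L₂ : List (Site 2)} (hS : S ≠ []) (hS' : S' ≠ [])
    (hQ : List.IsChain R (L₁ ++ S ++ L₂)) (hc : List.IsChain R S')
    (hh : S'.head hS' = S.head hS) (hl : S'.getLast hS' = S.getLast hS) : List.IsChain R (L₁ ++ S' ++ L₂) := by
  rw [List.isChain_append, List.isChain_append] at hQ ⊢
  obtain ⟨⟨h1, -, h3⟩, h4, h5⟩ := hQ
  refine ⟨⟨h1, hc, fun x hx y hy => h3 x hx y ?_⟩, h4, fun x hx y hy => h5 x ?_ y hy⟩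
  · rw [List.head?_eq_some_head hS', Option.mem_def, Option.some.injEq] at hy
    rw [List.head?_eq_some_head hS, Option.mem_def, Option.some.injEq, ← hh, hy]
  · rw [List.getLast?_eq_some_getLast (by simp [hS']), Option.mem_def, Option.some.injEq] at hx
    rw [List.getLast?_eq_some_getLast (by simp [hS]), Option.mem_def, Option.some.injEq, ← hx,
      List.getLast_append_of_right_ne_nil _ _ hS, List.getLast_append_of_right_ne_nil _ _ hS', hl]

/-- **Replacing a segment by distinct sites, old or new, keeps the list duplicate-free.** [folklore] -/
theorem nodup_append3_of_nodup {L₁ S S' L₂ : List (Site 2)} (hQ : (L₁ ++ S ++ L₂).Nodup) (hS' : S'.Nodup)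
    (hsub : ∀ s ∈ S', s ∈ S ∨ s ∉ L₁ ++ S ++ L₂) : (L₁ ++ S' ++ L₂).Nodup := by
  rw [List.append_assoc] at hQ ⊢
  rw [List.nodup_append] at hQ ⊢
  obtain ⟨h1, h23, hd⟩ := hQ
  rw [List.nodup_append] at h23 ⊢
  obtain ⟨h2, h3, hd23⟩ := h23
  refine ⟨h1, ⟨hS', h3, fun x hx y hy hxy => ?_⟩, fun x hx y hy hxy => ?_⟩
  · subst hxy
    rcases hsub x hx with h | h
    · exact hd23 x h x hy rfl
    · exact h (by simp [hy])
  · subst hxy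
    rcases List.mem_append.1 hy with hy | hy
    · rcases hsub x hy with h | h
      · exact hd x hx x (List.mem_append_left _ h) rfl
      · exact h (by simp [hx])
    · exact hd x hx x (List.mem_append_right _ hy) rfl

/-- A dart of a list splits it there. [folklore] -/
theorem exists_append_of_mem_pathDarts : ∀ {l : List (Site 2)} {a b : Site 2}, (a, b) ∈ pathDarts l →
    ∃ L₁ L₂, l = L₁ ++ a :: b :: L₂
  | [], _, _, h => by simp at h
  | [_], _, _, h => by simp at h
  | p :: q :: t, a, b, h => by
    rw [pathDarts_cons_cons, List.mem_cons] at h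
    rcases h with h | h
    · rw [Prod.mk.injEq] at h
      exact ⟨[], t, by rw [h.1, h.2]; rfl⟩
    · obtain ⟨L₁, L₂, e⟩ := exists_append_of_mem_pathDarts h
      exact ⟨p :: L₁, L₂, by rw [e]; rfl⟩

/-- A segment of a chain is a chain. [folklore] -/
theorem isChain_of_append3 {R : Site 2 → Site 2 → Prop} {L₁ S L₂ : List (Site 2)}
    (h : List.IsChain R (L₁ ++ S ++ L₂)) : List.IsChain R S :=
  (h.left_of_append).right_of_append

/-! ## The triangle loop around a face, from any vertex -/

/-- The boundary of a face, read from any vertex, is a lattice loop. [folklore] -/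
theorem isTriLoop_faceVertex' (w : HexVertex) (j : Fin 3) :
    IsTriLoop [faceVertex w j, faceVertex w (j + 1), faceVertex w (j + 2)] := by
  refine ⟨?_, by simp, ?_⟩
  · have h := faceVertex_injective w
    have h01 : faceVertex w j ≠ faceVertex w (j + 1) := fun e => absurd (add_eq_left.1 (h e).symm) (by decide)
    have h02 : faceVertex w j ≠ faceVertex w (j + 2) := fun e => absurd (add_eq_left.1 (h e).symm) (by decide)
    have h12 : faceVertex w (j + 1) ≠ faceVertex w (j + 2) := fun e =>
      absurd (add_left_cancel (h e)) (by decide)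
    simp [h01, h02, h12]
  · rw [cycDarts_triple]
    intro d hd
    simp only [List.mem_cons, List.not_mem_nil, or_false] at hd
    have e2 : j + 1 + 1 = j + 2 := by rw [add_assoc]; rfl
    have e3 : j + 2 + 1 = j := by rw [add_assoc]; exact add_eq_left.2 (by decide)
    rcases hd with rfl | rfl | rfl
    · exact TriMarkedDomain.adj_faceVertex_succ w j
    · rw [← e2]; exact TriMarkedDomain.adj_faceVertex_succ w (j + 1)
    · have := TriMarkedDomain.adj_faceVertex_succ w (j + 2); rwa [e3] at this

/-- The face has label `1` with respect to its boundary read from any vertex. [folklore] -/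
theorem faceLabel_triangle_self' (w : HexVertex) (j : Fin 3) :
    faceLabel (cycDarts [faceVertex w j, faceVertex w (j + 1), faceVertex w (j + 2)]) w = 1 := by
  rw [← faceLabel_triangle_self w, cycDarts_triple, cycDarts_triple]
  apply faceLabel_perm
  fin_cases j
  · exact List.Perm.refl _
  · simp only [Fin.mk_one, Fin.isValue, show (1 : Fin 3) + 1 = 2 from rfl, show (1 : Fin 3) + 2 = 0 from rfl]
    exact List.perm_append_comm (l₁ := [(faceVertex w 1, faceVertex w 2), (faceVertex w 2, faceVertex w 0)])
      (l₂ := [(faceVertex w 0, faceVertex w 1)])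
  · simp only [Fin.reduceFinMk, Fin.isValue, show (2 : Fin 3) + 1 = 0 from rfl, show (2 : Fin 3) + 2 = 1 from rfl]
    exact List.perm_append_comm (l₁ := [(faceVertex w 2, faceVertex w 0)])
      (l₂ := [(faceVertex w 0, faceVertex w 1), (faceVertex w 1, faceVertex w 2)])

/-! ## Periodicity of the chain of heads; target faces as faces left of boundary darts -/

namespace TriMarkedDomain

variable {k : ℕ} (D : TriMarkedDomain k)

/-- The chain of heads is periodic in the starting position. [folklore] -/
theorem headsList_add_card (m n : ℕ) : D.headsList (m + #(triBdryDarts D.verts)) n = D.headsList m n := by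
  induction n with
  | zero => simp [headsList_zero, bdryHead_add_card]
  | succ n ih =>
    rw [headsList_succ, headsList_succ, ih]
    have e1 : m + #(triBdryDarts D.verts) + n + 1 = (m + n + 1) + #(triBdryDarts D.verts) := by omega
    have e2 : m + #(triBdryDarts D.verts) + n = (m + n) + #(triBdryDarts D.verts) := by omega
    rw [e1, e2, D.bdryHead_add_card, D.bdryHead_add_card]

/-- The chord loop is periodic in the position of its end. [folklore] -/
theorem chordLoop_add_card (Q : List (Site 2)) (nv len : ℕ) :
    D.chordLoop Q (nv + #(triBdryDarts D.verts)) len = D.chordLoop Q nv len := by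
  unfold chordLoop; rw [D.headsList_add_card]

end TriMarkedDomain

namespace TriMarkedDomain

variable (D : TriMarkedDomain 3)

/-- **A face seen from the stretch `A₀` is the face left of a boundary dart of `A₀` or of the
previous dart** (read one period later, at positions `p + #∂` or `p + #∂ - 1`, `p < pos 1`). [folklore] -/
theorem exists_eq_leftFace_of_stretch_zero {F : HexVertex}
    (hF : ∃ d ∈ D.stretch 0, d.1 ∈ hexFaceVertices F ∧ d.2 ∈ hexFaceVertices F) :
    ∃ p, p < D.pos 1 ∧ (F = leftFace (triBdryIter D.verts D.base (p + #(triBdryDarts D.verts))).1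
        (D.bdryHead (p + #(triBdryDarts D.verts))) ∨
      F = leftFace (triBdryIter D.verts D.base (p + #(triBdryDarts D.verts) - 1)).1
        (D.bdryHead (p + #(triBdryDarts D.verts) - 1))) := by
  set L := #(triBdryDarts D.verts) with hL
  have hL3 : 3 ≤ L := D.three_le_card 0
  have hadjq : ∀ q, triGraph.Adj (triBdryIter D.verts D.base q).1 (D.bdryHead q) := fun q => D.adj_fst_bdryHead q
  obtain ⟨d, hd, hd1, hd2⟩ := hF
  obtain ⟨p, hp, rfl⟩ := D.mem_stretch_zero_iff3.1 hd
  refine ⟨p, hp, ?_⟩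
  have hper : triBdryIter D.verts D.base (p + L) = triBdryIter D.verts D.base p := D.iter_add_card p
  rw [← hper] at hd1 hd2
  change D.bdryHead (p + L) ∈ hexFaceVertices F at hd2
  rcases eq_leftFace_or_of_mem_of_mem (hadjq (p + L)) hd1 hd2 with hFeq | hFeq
  · exact Or.inl hFeq
  · right
    rw [hFeq]
    have ep : p + L - 1 + 1 = p + L := by omega
    have hot : triGraph.Adj (D.bdryHead (p + L)) (triBdryIter D.verts D.base (p + L)).1 := (hadjq (p + L)).symm
    rcases D.iter_succ_eq_or (p + L - 1) with ⟨h, -⟩ | ⟨h, -⟩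
    · rw [ep] at h
      have ht : (triBdryIter D.verts D.base (p + L)).1 = (triBdryIter D.verts D.base (p + L - 1)).1 := by
        show (triBdryIter D.verts D.base (p + L)).1 = _; rw [h]
      have ho : D.bdryHead (p + L) = triLeftApex (triBdryIter D.verts D.base (p + L - 1)).1 (D.bdryHead (p + L - 1)) := by
        show (triBdryIter D.verts D.base (p + L)).2 = _; rw [h]; rfl
      have hho : triGraph.Adj (D.bdryHead (p + L - 1)) (D.bdryHead (p + L)) := by
        rw [ho]; exact (triGraph_adj_triLeftApex_right (hadjq (p + L - 1))).symm
      have hapex1 : triLeftApex (D.bdryHead (p + L - 1)) (D.bdryHead (p + L)) =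
          (triBdryIter D.verts D.base (p + L)).1 := by
        rw [ho, triLeftApex_triLeftApex (hadjq (p + L - 1)), ht]
      have hapex2 : triLeftApex (D.bdryHead (p + L)) (triBdryIter D.verts D.base (p + L)).1 = D.bdryHead (p + L - 1) := by
        rw [← hapex1, triLeftApex_triLeftApex hho]
      refine eq_leftFace_of_mem (hadjq (p + L - 1)) ?_ ?_ ?_
      · rw [hexFaceVertices_leftFace hot, ← ht]; simp
      · rw [hexFaceVertices_leftFace hot, hapex2]; simp
      · rw [hexFaceVertices_leftFace hot, ← ho]; simp
    · rw [ep] at h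
      have ht : (triBdryIter D.verts D.base (p + L)).1 =
          triLeftApex (triBdryIter D.verts D.base (p + L - 1)).1 (D.bdryHead (p + L - 1)) := by
        show (triBdryIter D.verts D.base (p + L)).1 = _; rw [h]; rfl
      have ho : D.bdryHead (p + L) = D.bdryHead (p + L - 1) := by
        show (triBdryIter D.verts D.base (p + L)).2 = _; rw [h]; rfl
      refine eq_leftFace_of_mem (hadjq (p + L - 1)) ?_ ?_ ?_
      · rw [hexFaceVertices_leftFace hot, ht, ho, triLeftApex_triLeftApex (hadjq (p + L - 1))]; simp
      · rw [hexFaceVertices_leftFace hot, ho]; simp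
      · rw [hexFaceVertices_leftFace hot, ← ht]; simp

end TriMarkedDomain

/-- **The darts of the support of a walk are its darts.** [folklore] -/
theorem mem_pathDarts_support_iff {u v : Site 2} (p : triGraph.Walk u v) {x y : Site 2} :
    (x, y) ∈ pathDarts p.support ↔ ∃ d ∈ p.darts, d.toProd = (x, y) := by
  induction p with
  | nil => simp
  | @cons a b c h q ih =>
    rw [SimpleGraph.Walk.darts_cons, SimpleGraph.Walk.support_cons]
    have hq : q.support = b :: q.support.tail := (q.cons_tail_support).symm
    rw [hq, pathDarts_cons_cons, ← hq, List.mem_cons, ih]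
    constructor
    · rintro (h | ⟨d, hd, hd'⟩)
      · exact ⟨_, List.mem_cons_self, by rw [Prod.mk.injEq] at h; rw [h.1, h.2]⟩
      · exact ⟨d, List.mem_cons_of_mem _ hd, hd'⟩
    · rintro ⟨d, hd, hd'⟩
      rw [List.mem_cons] at hd
      rcases hd with rfl | hd
      · left; exact hd'.symm
      · exact Or.inr ⟨d, hd, hd'⟩
end Literature.Probability.Percolation
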